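/-
Copyright (c) 2026 the pub-hodgecm-mathlib formalisation cell (harness21).  Prover seat hodgecm-mathlib-K2E3-p34 (g2), Track B «K2-LIT» ∕ h413 = `stmt-HodgeConjecture-24833`,
line `K2_E3_EllipticInputs`, unit U4 «Keys», socket :182 `sig_K2E3KeysThmTwoContractingRamifiedCharOnePosDepth`, programme A_pos^{<}: brick (N-T)-CM «THE LETTER `hwit` ON AN
UPPER SHELL OF `U(Φ₃)(L⁺_v)`» — CM dress of ★ `K2E3TwoDepthUpperShellTransport` (this seat), the upper-shell twin of ★ `K2E3LevelNDepthWitnessCM` §3 (R90-C10-p02 (g2)); dealer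
K2E3-plan (g5), K2 bus 2026-09-04T22:47Z.  KERNEL module: THEOREMS ONLY.
-/
import Summits.HodgeConjecture.HodgeConjecture.Theorems.K2E3LevelNDepthWitnessCM             -- ★ §10 (b) (R90-C10-p02 g2): the (G3) frame, `symm_mem_N_of_mem_unipotentU`, `tau_apply_one_eq_one_of_mem_N`; brings ★ Z2A-3b `coe_eA_apply`, `isUnit_of_apply_ne_zero`, `map_mem_map_of_mem_map`
import Summits.HodgeConjecture.HodgeConjecture.Theorems.K2E3TwoDepthUpperShellTransport       -- ★ (N-T) (this seat): MODEL `exists_upperShell_witness_of_exists`; brings ★ D174's letters `e Jg hJg`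
import Summits.HodgeConjecture.HodgeConjecture.Theorems.K2E3LowerUnipotentDeepCellCM           -- ★ (ii)^{<}-CM (this seat): `symm_mem_comap_of_mem` (`eA⁻¹ b ∈ Je` for `b ∈ Jg`)
import HarnessLib

/-!
# K2 ∕ E3 «EllipticInputs», unit U4 «Keys» — (U4f-χ₁-ram-one-pos), programme A_pos^{<} brick (N-T)-CM: THE LETTER `hwit` OF THE CELL-FAMILY ENGINE ON AN UPPER SHELL
# OF THE BIG CELL, FOR THE TWO-DEPTH GROUP `J_e` ON `U(Φ₃)(L⁺_v)` — «a chart-(I) model witness for the SWAPPED group at `ū(x∕z, 1∕z)` ⟹ `∃ b₀ ∈ Je`, `r b₀ r⁻¹ ∈ P`,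
# `θ(b₀) = χ₁(u₁) ≠ 1 = τ(r b₀ r⁻¹)`»   [Roche1998 §4; Casselman1995 §6.3; Rogawski1990 §1.10, §12.1; PlatonovRapinchuk1994 §5.1]

Cell hodgecm-mathlib, Track B «K2-LIT», crux item H413 = stmt-HodgeConjecture-24833 (route `HCCMUnconditional`, no route verbs); target BY NAME the OPEN tier-0 leaf
`…K2E3EllipticInputs.U4Keys.sig_K2E3KeysThmTwoContractingRamifiedCharOnePosDepth` (U4Keys :182), regime A_pos^{<}.  Author K2E3-p34 (g2).  `--supports stmt-HodgeConjecture-24833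
--as helper`; THEOREMS ONLY.  Frame = ★ `K2E3LevelNDepthWitnessCM`'s (`L v w hw eA heA ϖ hϖ`, `w₀ hw₀`) with ★ D174's model letters `e Jg hJg`, the SWAPPED test `Jgw hJgw`
(`k ∈ Jgw ↔ ∀ i j, |k i j| ≤ |ϖ| ^ e (rev i) (rev j)`) and ★ (v)-CM^{<}'s `Je (hJe : Je = Jg.comap eA)`.  NOT THE PAYER of :182.

THE POINT.  The engine ★ p861573 at `B := Je` needs, for each representative `r` of the two-depth cell family, `b₀ ∈ Je` with `r b₀ r⁻¹ ∈ P` and `θ(b₀) ≠ τ(r b₀ r⁻¹)·1`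
(`θ(g) = χ₁(g₀₀)` read as a unit of `L ⊗ L⁺_v`, `τ = ((1 ⊗ (χ₁, 1)) ∘ proj) ⊗ δ^{1∕2}`).  ★ `K2E3LevelNDepthWitnessCM` §3 does this on the LOWER (intermediate) shells from the
model witnesses X∕Z; THIS FILE does it on the UPPER shells `r ∈ N̄`, `eA r = ū(x, z)`, `z ≠ 0` (off the deep∕sharp big cell ★ p862537∕p862590), HYPOTHESIS-FIRST over the
MODEL witness package for the SWAPPED group at `ū′ := ū(x∕z, 1∕z)` — `∃ u″ ∈ N_w, ū′⁻¹u″ū′ ∈ Jgw ∧ ∃ ε, |ε| ≤ |ϖ|^{m+1} ∧ (ū′⁻¹u″ū′)₀₀ = (1+c)(1+ε)`, the conclusion of ★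
`K2E3TwoDepthDepthWitness` (K2E3-p37 (g2)) read with `hJgw`, supplied by its cover for Roche's swapped exponents — tied to the CM exact-conductor witness `u₁` by ONE letter
`hcu : σ_w(1 + c) = (u₁)_w` (family X: `c := σ_w((u₁)_w) − 1`; family Z: `c := (u₁)_w − 1`, `σu₁ = u₁`).  Then ★ (N-T) gives the model `b₀′ ∈ Jg` with
`ū(x,z)·b₀′·ū(x,z)⁻¹ ∈ N_w`, `(b₀′)₀₀ = σ_w(1+c)·(1+ε′)`; `b₀ := eA⁻¹ b₀′ ∈ Je`, `r b₀ r⁻¹ = eA⁻¹(…) ∈ N ⊆ P` (★ `symm_mem_N_of_mem_unipotentU`), `τ = 1` there (★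
`tau_apply_one_eq_one_of_mem_N`), and `θ(b₀) = χ₁((u₁)·e)` with `e ≡ 1 (mod 𝔭^{m+1})` at the one place, so `θ(b₀) = χ₁(u₁) ≠ 1` (letters `hcond`, `hu₁`, `hχu₁` of ★ §10 (b) VERBATIM).
* **`exists_upperShellWitness_of_model`** (ED. 1) and **`exists_upperShellWitness_of_model_of_unit`** (ED. 2, append-only: no depth binder on the witness unit — serves the
  F-side witness `u₂` of depth `k ≤ m`, `k = 0` allowed); — the letter `hwit` on an upper shell, conclusion BYTE-IDENTICAL in shape to ★ `K2E3LevelNDepthWitnessCM.exists_depthWitness_of_mem_map_of_not_mem`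
  with `Jn ↦ Je`.
HONEST LABEL: HC_CM is proved only modulo the 7 printed citations (2 remaining named inputs: hLiu418 = stmt-HodgeConjecture-24832, h413 = stmt-HodgeConjecture-24833)
until rung 0 closes; count-neutral — this file does NOT pay the leaf; no printed citation is discharged.

## References
* [Roche1998] A. Roche, *Types and Hecke algebras for principal series representations of split reductive p-adic groups*, Ann. Sci. ÉNS (4) 31 (1998), §4 (relevance of `P g J`).
* [Casselman1995] W. Casselman, *Introduction to the theory of admissible representations of `p`-adic reductive groups* (1995), §6.3–§6.4.
* [Rogawski1990] J. D. Rogawski, *Automorphic Representations of Unitary Groups in Three Variables*, Ann. of Math. Stud. 123 (1990), §1.9–§1.10 pp. 8–9, §12.1 p. 171.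
* [PlatonovRapinchuk1994] V. Platonov, A. Rapinchuk, *Algebraic Groups and Number Theory* (1994), §5.1 (one place above a non-split `v`).
-/

set_option autoImplicit false
-- the mandated namespace has the single-problem summit's repeated segment (`HodgeConjecture.HodgeConjecture`)
set_option linter.dupNamespace false

noncomputable section

open NumberField IsDedekindDomain
open scoped Matrix MatrixGroups WithZero Valued
open Literature.NumberTheory Literature.NumberTheory.Automorphic Literature.NumberTheory.Automorphic.UnitaryGroup
open Literature.NumberTheory.Rogawski1990

namespace Summit.HodgeConjecture.HodgeConjecture.Cruxes.H413.K2E3TwoDepthUpperShellWitnessCM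

open Summit.HodgeConjecture.HodgeConjecture.Cruxes.H413
open Summit.HodgeConjecture.HodgeConjecture.Cruxes.H413.K2E3DepthZeroIwahoriCharacterCM
open Summit.HodgeConjecture.HodgeConjecture.Cruxes.H413.K2E3LevelNDepthWitnessCM

variable (L : Type) [Field L] [NumberField L] [IsCMField L] (v : HeightOneSpectrum (𝓞 ↥(maximalRealSubfield L)))
  (w : PlacesOver L v) (hw : IsCMField.complexConj L • w.1 = w.1)
  (eA : Gqs L v ≃ₜ* ↥(unitaryGroupOfForm (galAdicCompletionMap (L := L) (IsCMField.complexConj L) hw) ((StdForm.antidiagonal 3).over (w.1.adicCompletion L))))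
  (heA : ∀ g : Gqs L v,
    ((eA g : ↥(unitaryGroupOfForm (galAdicCompletionMap (L := L) (IsCMField.complexConj L) hw) ((StdForm.antidiagonal 3).over (w.1.adicCompletion L)))) :
        GL (Fin 3) (w.1.adicCompletion L)) =
      ((localNonsplitEquiv (IsCMField.complexConj L) (qsForm L) (IsCMField.complexConj_ne_one L) w hw g :
        ↥(unitaryGroupOfForm (galAdicCompletionMap (L := L) (IsCMField.complexConj L) hw) (placeForm (qsForm L) w.1))) : GL (Fin 3) (w.1.adicCompletion L)))
  {ϖ : w.1.adicCompletion L} (hϖ : Valued.v ϖ = WithZero.exp (-1 : ℤ))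
  (e : Fin 3 → Fin 3 → ℕ)
  (Jg Jgw : Subgroup ↥(unitaryGroupOfForm (galAdicCompletionMap (L := L) (IsCMField.complexConj L) hw) ((StdForm.antidiagonal 3).over (w.1.adicCompletion L))))
  (hJg : ∀ k : ↥(unitaryGroupOfForm (galAdicCompletionMap (L := L) (IsCMField.complexConj L) hw) ((StdForm.antidiagonal 3).over (w.1.adicCompletion L))),
    k ∈ Jg ↔ ∀ i j, Valued.v (((k : GL (Fin 3) (w.1.adicCompletion L)) : Matrix (Fin 3) (Fin 3) (w.1.adicCompletion L)) i j) ≤ Valued.v ϖ ^ e i j)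
  (hJgw : ∀ k : ↥(unitaryGroupOfForm (galAdicCompletionMap (L := L) (IsCMField.complexConj L) hw) ((StdForm.antidiagonal 3).over (w.1.adicCompletion L))),
    k ∈ Jgw ↔ ∀ i j, Valued.v (((k : GL (Fin 3) (w.1.adicCompletion L)) : Matrix (Fin 3) (Fin 3) (w.1.adicCompletion L)) i j) ≤ Valued.v ϖ ^ e (Fin.rev i) (Fin.rev j))
  (Je : Subgroup (Gqs L v)) (hJe : Je = Jg.comap eA.toMulEquiv.toMonoidHom)

/-! ## The letter `hwit` on an upper shell -/

open Classical in
include hw heA hϖ hJg hJgw hJe in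
set_option maxHeartbeats 400000 in
-- the `U(Φ₃)(L⁺_v)`-valued products are read in two definitionally equal carriers (`Gqs L v` and the matrix subgroup); measured (default 200000 insufficient for this class, cf. ★ `K2E3LevelNDepthWitnessCM` §3 at 1600000)
/-- **THE LETTER `hwit` ON AN UPPER SHELL (programme A_pos^{<}, CM dress of ★ `K2E3TwoDepthUpperShellTransport`).**  Frame: `v` non-split, `w ∣ v`, `eA`, a uniformiser `ϖ`; the
two-depth group `Je = eA⁻¹(Jg)` with anti-transpose-symmetric exponents `e`; `1 ≤ m`.  Letters: `χ₁ : (L ⊗ L⁺_v)ˣ → ℂˣ` with `hcond` (`χ₁ u = 1` whenever `|u_{w′} − 1| ≤ |ϖ|^{m+1}`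
for all `w′`) and a witness unit `u₁` with `|(u₁)_{w′} − 1| ≤ |ϖ|ᵐ`, `χ₁ u₁ ≠ 1` (★ §10 (b)'s letters VERBATIM); a representative `r ∈ N̄ = N.map (conj w₀)` whose place reading is
`eA r = ū(x, z)` with `z ≠ 0`, the integral point `ū′` of matrix `ū(x∕z, 1∕z)`, and a MODEL witness package for `ū′` in the SWAPPED group `Jgw` (★ `K2E3TwoDepthDepthWitness` read with
`hJgw`) whose constant `c` is tied to `u₁` by `σ_w(1 + c) = (u₁)_w`.  Then `∃ b₀ ∈ Je` with `r b₀ r⁻¹ ∈ P` and `θ(b₀) ≠ (((1 ⊗ (χ₁, 1)) ∘ proj) ⊗ δ^{1∕2})(r b₀ r⁻¹)·1`, for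
`θ(g) = if h : IsUnit g₀₀ then χ₁(h.unit) else 0`: indeed `θ(b₀) = χ₁ u₁ ≠ 1` while the right-hand side is `1` (`r b₀ r⁻¹ ∈ N`).
[cite: Roche1998, §4] [cite: Casselman1995, §6.3] [cite: Rogawski1990, §1.10 p. 9] [cite: Rogawski1990, §12.1 p. 171] [cite: PlatonovRapinchuk1994, §5.1] -/
theorem exists_upperShellWitness_of_model (hsym : ∀ i j, e (Fin.rev j) (Fin.rev i) = e i j) {m : ℕ} (hm : 1 ≤ m)
    (χ₁ : (LocalRing L v)ˣ →* ℂˣ)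
    (hcond : ∀ u : (LocalRing L v)ˣ, (∀ w' : PlacesOver L v, Valued.v (((u : LocalRing L v) w') - 1) ≤ Valued.v ϖ ^ (m + 1)) → χ₁ u = 1)
    (u₁ : (LocalRing L v)ˣ) (hu₁ : ∀ w' : PlacesOver L v, Valued.v (((u₁ : LocalRing L v) w') - 1) ≤ Valued.v ϖ ^ m) (hχu₁ : χ₁ u₁ ≠ 1)
    {r : Gqs L v} {x z c : w.1.adicCompletion L}
    (hxz : (((eA r : ↥(unitaryGroupOfForm (galAdicCompletionMap (L := L) (IsCMField.complexConj L) hw) ((StdForm.antidiagonal 3).over (w.1.adicCompletion L)))) :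
        GL (Fin 3) (w.1.adicCompletion L)) : Matrix (Fin 3) (Fin 3) (w.1.adicCompletion L)) =
        !![1, 0, 0; -(galAdicCompletionMap (L := L) (IsCMField.complexConj L) hw) x, 1, 0; z, x, 1])
    (hrel : z + (galAdicCompletionMap (L := L) (IsCMField.complexConj L) hw) z + x * (galAdicCompletionMap (L := L) (IsCMField.complexConj L) hw) x = 0) (hz : z ≠ 0)
    {nb' : ↥(unitaryGroupOfForm (galAdicCompletionMap (L := L) (IsCMField.complexConj L) hw) ((StdForm.antidiagonal 3).over (w.1.adicCompletion L)))}
    (hnb' : ((nb' : GL (Fin 3) (w.1.adicCompletion L)) : Matrix (Fin 3) (Fin 3) (w.1.adicCompletion L)) =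
      !![1, 0, 0; -(galAdicCompletionMap (L := L) (IsCMField.complexConj L) hw) (x / z), 1, 0; z⁻¹, x / z, 1])
    (hwit : ∃ u'' : ↥(unitaryGroupOfForm (galAdicCompletionMap (L := L) (IsCMField.complexConj L) hw) ((StdForm.antidiagonal 3).over (w.1.adicCompletion L))),
      u'' ∈ unipotentU (galAdicCompletionMap (L := L) (IsCMField.complexConj L) hw) ((StdForm.antidiagonal 3).over (w.1.adicCompletion L)) ∧ nb'⁻¹ * u'' * nb' ∈ Jgw ∧
      ∃ ε : w.1.adicCompletion L, Valued.v ε ≤ Valued.v ϖ ^ (m + 1) ∧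
        (((nb'⁻¹ * u'' * nb' : ↥(unitaryGroupOfForm (galAdicCompletionMap (L := L) (IsCMField.complexConj L) hw) ((StdForm.antidiagonal 3).over (w.1.adicCompletion L)))) :
          GL (Fin 3) (w.1.adicCompletion L)) : Matrix (Fin 3) (Fin 3) (w.1.adicCompletion L)) 0 0 = (1 + c) * (1 + ε))
    (hcu : (galAdicCompletionMap (L := L) (IsCMField.complexConj L) hw) (1 + c) = (u₁ : LocalRing L v) w) :
    ∃ (b₀ : Gqs L v) (hb₀P : ((r * b₀ * r⁻¹ : Gqs L v) : ↥(unitaryGroupOfForm (conjLocal L (IsCMField.complexConj L) v) (cmLocalForm L 3 v))) ∈ (cmBorelTriple L 3 v).P),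
      b₀ ∈ Je ∧
      (if h : IsUnit (((b₀.val : GL (Fin 3) (LocalRing L v)) : Matrix (Fin 3) (Fin 3) (LocalRing L v)) 0 0) then ((χ₁ h.unit : ℂˣ) : ℂ) else 0) ≠
        (haveI := locallyCompactSpace_cmBorelU L 3 v
         (Representation.twist
            (((Representation.trivial ℂ ↥(torusU (conjLocal L (IsCMField.complexConj L) v) (cmLocalForm L 3 v)) ℂ).twist
              (cmTorusCharPair L v χ₁ 1)).comp (cmBorelTriple L 3 v).proj) (rootDeltaChar (cmBorelTriple L 3 v).P))
          ⟨((r * b₀ * r⁻¹ : Gqs L v) : ↥(unitaryGroupOfForm (conjLocal L (IsCMField.complexConj L) v) (cmLocalForm L 3 v))), hb₀P⟩ 1) := by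
  haveI := locallyCompactSpace_cmBorelU L 3 v
  have hσσ : ∀ x, (galAdicCompletionMap (L := L) (IsCMField.complexConj L) hw) ((galAdicCompletionMap (L := L) (IsCMField.complexConj L) hw) x) = x :=
    galAdicCompletionMap_galAdicCompletionMap_of_smul_eq (IsCMField.complexConj L) w (IsCMField.complexConj_ne_one L) hw
  have hvσ : ∀ x, Valued.v (galAdicCompletionMap (L := L) (IsCMField.complexConj L) hw x) = Valued.v x :=
    fun x => valued_galAdicCompletionMap (L := L) (IsCMField.complexConj L) hw x
  -- ★ (N-T): the model witness `b₀′ ∈ Jg`, `ū(x,z) b₀′ ū(x,z)⁻¹ ∈ N_w`, `(b₀′)₀₀ = σ(1+c)(1+ε′)`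
  obtain ⟨b, hbJ, hbN, ε', hε', hb00⟩ := K2E3TwoDepthUpperShellTransport.exists_upperShell_witness_of_exists
    (galAdicCompletionMap (L := L) (IsCMField.complexConj L) hw) (rfl : (StdForm.antidiagonal 3).over (w.1.adicCompletion L) = _) hσσ hvσ e Jg Jgw hJg hJgw hsym
    hxz hrel hz hnb' hwit
  -- `b₀ := eA⁻¹ b₀′`; `r b₀ r⁻¹ = eA⁻¹(eA r · b₀′ · (eA r)⁻¹) ∈ N`
  have hconj : r * eA.symm b * r⁻¹ = eA.symm (eA r * b * (eA r)⁻¹) := by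
    apply eA.injective
    rw [ContinuousMulEquiv.apply_symm_apply, map_mul, map_mul, map_inv, ContinuousMulEquiv.apply_symm_apply]
  have hN : ((r * eA.symm b * r⁻¹ : Gqs L v) : ↥(unitaryGroupOfForm (conjLocal L (IsCMField.complexConj L) v) (cmLocalForm L 3 v))) ∈ (cmBorelTriple L 3 v).N := by
    rw [hconj]
    exact symm_mem_N_of_mem_unipotentU L v w hw eA heA hbN
  refine ⟨eA.symm b, (cmBorelTriple L 3 v).N_le hN, K2E3LowerUnipotentDeepCellCM.symm_mem_comap_of_mem L v w hw eA Jg Je hJe hbJ, ?_⟩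
  -- right-hand side `= 1`
  rw [tau_apply_one_eq_one_of_mem_N L v χ₁ hN]
  -- the `w`-component of `(b₀)₀₀` is `(u₁)_w (1 + ε′)`
  have h00w : ((((eA.symm b).val : GL (Fin 3) (LocalRing L v)) : Matrix (Fin 3) (Fin 3) (LocalRing L v)) 0 0 w) = (u₁ : LocalRing L v) w * (1 + ε') := by
    rw [← coe_eA_apply L v w hw eA heA (eA.symm b) 0 0, ContinuousMulEquiv.apply_symm_apply, hb00, hcu]
  have hu₁w : Valued.v ((u₁ : LocalRing L v) w) = 1 := by
    have hlt : Valued.v (((u₁ : LocalRing L v) w) - 1) < 1 := by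
      refine lt_of_le_of_lt (hu₁ w) (pow_lt_one' ?_ (Nat.one_le_iff_ne_zero.1 hm))
      rw [hϖ, ← WithZero.exp_zero, WithZero.exp_lt_exp]; norm_num
    have e1 : (u₁ : LocalRing L v) w = 1 + (((u₁ : LocalRing L v) w) - 1) := by ring
    rw [e1, Valued.v.map_one_add_of_lt hlt]
  have hu₁w0 : (u₁ : LocalRing L v) w ≠ 0 := fun h => by rw [h, map_zero] at hu₁w; exact zero_ne_one hu₁w
  have hε'1 : Valued.v (1 + ε') = 1 := by
    refine Valued.v.map_one_add_of_lt (lt_of_le_of_lt hε' (pow_lt_one' ?_ (Nat.succ_ne_zero m)))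
    rw [hϖ, ← WithZero.exp_zero, WithZero.exp_lt_exp]; norm_num
  have hε'0 : 1 + ε' ≠ 0 := fun h => by rw [h, map_zero] at hε'1; exact zero_ne_one hε'1
  have hU : IsUnit ((((eA.symm b).val : GL (Fin 3) (LocalRing L v)) : Matrix (Fin 3) (Fin 3) (LocalRing L v)) 0 0) := by
    refine isUnit_of_apply_ne_zero L v w hw _ ?_
    rw [h00w]
    exact mul_ne_zero hu₁w0 hε'0
  rw [dif_pos hU]
  -- `e := unit (b₀)₀₀ · u₁⁻¹ ≡ 1 (mod 𝔭^{m+1})` at every place, hence killed by `χ₁`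
  have he : ∀ w' : PlacesOver L v, Valued.v ((((hU.unit * u₁⁻¹ : (LocalRing L v)ˣ)) : LocalRing L v) w' - 1) ≤ Valued.v ϖ ^ (m + 1) := by
    intro w'
    obtain rfl := (PlacesOver.eq_of_smul_eq (IsCMField.complexConj L) (IsCMField.complexConj_ne_one L) w hw w').symm
    rw [Units.val_mul, Units.val_inv_eq_inv_val, Pi.mul_apply, Pi.inv_apply, IsUnit.unit_spec, h00w,
      show (u₁ : LocalRing L v) w * (1 + ε') * ((u₁ : LocalRing L v) w)⁻¹ - 1 = ε' by field_simp; ring]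
    exact hε'
  have hχe := hcond _ he
  have hunit : hU.unit = (hU.unit * u₁⁻¹) * u₁ := by rw [inv_mul_cancel_right]
  rw [hunit, map_mul, hχe, one_mul]
  intro heq
  exact hχu₁ (Units.val_eq_one.1 heq)

open Classical in
include hw heA hϖ hJg hJgw hJe in
set_option maxHeartbeats 400000 in
-- as above (measured class)
/-- **ED. 2 (append-only) — the same letter WITHOUT a depth hypothesis on the witness unit.**  ★ `exists_upperShellWitness_of_model` asks `1 ≤ m` and `|(u₁)_{w′} − 1| ≤ |ϖ|ᵐ` only to
know `(u₁)_w ≠ 0`, which holds for EVERY unit of `L ⊗ L⁺_v = Π_{w′} L_{w′}`; this variant drops both binders so that the assembly can feed the F-side witness `u₂` (depth `k ≤ m`,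
possibly `k = 0`) on the `c = c₂` branch of ★ `K2E3TwoDepthUpperShellCover.exists_upperShell_witness_package` exactly as it feeds `u₁` on the `c = c₁` branch.  All ED. 1 declarations
above are byte-identical. [cite: Roche1998, §4] [cite: Casselman1995, §6.3] [cite: Rogawski1990, §12.1 p. 171] [cite: PlatonovRapinchuk1994, §5.1] -/
theorem exists_upperShellWitness_of_model_of_unit (hsym : ∀ i j, e (Fin.rev j) (Fin.rev i) = e i j) {m : ℕ}
    (χ₁ : (LocalRing L v)ˣ →* ℂˣ)
    (hcond : ∀ u : (LocalRing L v)ˣ, (∀ w' : PlacesOver L v, Valued.v (((u : LocalRing L v) w') - 1) ≤ Valued.v ϖ ^ (m + 1)) → χ₁ u = 1)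
    (u₁ : (LocalRing L v)ˣ) (hχu₁ : χ₁ u₁ ≠ 1)
    {r : Gqs L v} {x z c : w.1.adicCompletion L}
    (hxz : (((eA r : ↥(unitaryGroupOfForm (galAdicCompletionMap (L := L) (IsCMField.complexConj L) hw) ((StdForm.antidiagonal 3).over (w.1.adicCompletion L)))) :
        GL (Fin 3) (w.1.adicCompletion L)) : Matrix (Fin 3) (Fin 3) (w.1.adicCompletion L)) =
        !![1, 0, 0; -(galAdicCompletionMap (L := L) (IsCMField.complexConj L) hw) x, 1, 0; z, x, 1])
    (hrel : z + (galAdicCompletionMap (L := L) (IsCMField.complexConj L) hw) z + x * (galAdicCompletionMap (L := L) (IsCMField.complexConj L) hw) x = 0) (hz : z ≠ 0)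
    {nb' : ↥(unitaryGroupOfForm (galAdicCompletionMap (L := L) (IsCMField.complexConj L) hw) ((StdForm.antidiagonal 3).over (w.1.adicCompletion L)))}
    (hnb' : ((nb' : GL (Fin 3) (w.1.adicCompletion L)) : Matrix (Fin 3) (Fin 3) (w.1.adicCompletion L)) =
      !![1, 0, 0; -(galAdicCompletionMap (L := L) (IsCMField.complexConj L) hw) (x / z), 1, 0; z⁻¹, x / z, 1])
    (hwit : ∃ u'' : ↥(unitaryGroupOfForm (galAdicCompletionMap (L := L) (IsCMField.complexConj L) hw) ((StdForm.antidiagonal 3).over (w.1.adicCompletion L))),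
      u'' ∈ unipotentU (galAdicCompletionMap (L := L) (IsCMField.complexConj L) hw) ((StdForm.antidiagonal 3).over (w.1.adicCompletion L)) ∧ nb'⁻¹ * u'' * nb' ∈ Jgw ∧
      ∃ ε : w.1.adicCompletion L, Valued.v ε ≤ Valued.v ϖ ^ (m + 1) ∧
        (((nb'⁻¹ * u'' * nb' : ↥(unitaryGroupOfForm (galAdicCompletionMap (L := L) (IsCMField.complexConj L) hw) ((StdForm.antidiagonal 3).over (w.1.adicCompletion L)))) :
          GL (Fin 3) (w.1.adicCompletion L)) : Matrix (Fin 3) (Fin 3) (w.1.adicCompletion L)) 0 0 = (1 + c) * (1 + ε))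
    (hcu : (galAdicCompletionMap (L := L) (IsCMField.complexConj L) hw) (1 + c) = (u₁ : LocalRing L v) w) :
    ∃ (b₀ : Gqs L v) (hb₀P : ((r * b₀ * r⁻¹ : Gqs L v) : ↥(unitaryGroupOfForm (conjLocal L (IsCMField.complexConj L) v) (cmLocalForm L 3 v))) ∈ (cmBorelTriple L 3 v).P),
      b₀ ∈ Je ∧
      (if h : IsUnit (((b₀.val : GL (Fin 3) (LocalRing L v)) : Matrix (Fin 3) (Fin 3) (LocalRing L v)) 0 0) then ((χ₁ h.unit : ℂˣ) : ℂ) else 0) ≠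
        (haveI := locallyCompactSpace_cmBorelU L 3 v
         (Representation.twist
            (((Representation.trivial ℂ ↥(torusU (conjLocal L (IsCMField.complexConj L) v) (cmLocalForm L 3 v)) ℂ).twist
              (cmTorusCharPair L v χ₁ 1)).comp (cmBorelTriple L 3 v).proj) (rootDeltaChar (cmBorelTriple L 3 v).P))
          ⟨((r * b₀ * r⁻¹ : Gqs L v) : ↥(unitaryGroupOfForm (conjLocal L (IsCMField.complexConj L) v) (cmLocalForm L 3 v))), hb₀P⟩ 1) := by
  haveI := locallyCompactSpace_cmBorelU L 3 v
  have hσσ : ∀ x, (galAdicCompletionMap (L := L) (IsCMField.complexConj L) hw) ((galAdicCompletionMap (L := L) (IsCMField.complexConj L) hw) x) = x :=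
    galAdicCompletionMap_galAdicCompletionMap_of_smul_eq (IsCMField.complexConj L) w (IsCMField.complexConj_ne_one L) hw
  have hvσ : ∀ x, Valued.v (galAdicCompletionMap (L := L) (IsCMField.complexConj L) hw x) = Valued.v x :=
    fun x => valued_galAdicCompletionMap (L := L) (IsCMField.complexConj L) hw x
  -- ★ (N-T): the model witness `b₀′ ∈ Jg`, `ū(x,z) b₀′ ū(x,z)⁻¹ ∈ N_w`, `(b₀′)₀₀ = σ(1+c)(1+ε′)`
  obtain ⟨b, hbJ, hbN, ε', hε', hb00⟩ := K2E3TwoDepthUpperShellTransport.exists_upperShell_witness_of_exists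
    (galAdicCompletionMap (L := L) (IsCMField.complexConj L) hw) (rfl : (StdForm.antidiagonal 3).over (w.1.adicCompletion L) = _) hσσ hvσ e Jg Jgw hJg hJgw hsym
    hxz hrel hz hnb' hwit
  -- `b₀ := eA⁻¹ b₀′`; `r b₀ r⁻¹ = eA⁻¹(eA r · b₀′ · (eA r)⁻¹) ∈ N`
  have hconj : r * eA.symm b * r⁻¹ = eA.symm (eA r * b * (eA r)⁻¹) := by
    apply eA.injective
    rw [ContinuousMulEquiv.apply_symm_apply, map_mul, map_mul, map_inv, ContinuousMulEquiv.apply_symm_apply]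
  have hN : ((r * eA.symm b * r⁻¹ : Gqs L v) : ↥(unitaryGroupOfForm (conjLocal L (IsCMField.complexConj L) v) (cmLocalForm L 3 v))) ∈ (cmBorelTriple L 3 v).N := by
    rw [hconj]
    exact symm_mem_N_of_mem_unipotentU L v w hw eA heA hbN
  refine ⟨eA.symm b, (cmBorelTriple L 3 v).N_le hN, K2E3LowerUnipotentDeepCellCM.symm_mem_comap_of_mem L v w hw eA Jg Je hJe hbJ, ?_⟩
  -- right-hand side `= 1`
  rw [tau_apply_one_eq_one_of_mem_N L v χ₁ hN]
  -- the `w`-component of `(b₀)₀₀` is `(u₁)_w (1 + ε′)`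
  have h00w : ((((eA.symm b).val : GL (Fin 3) (LocalRing L v)) : Matrix (Fin 3) (Fin 3) (LocalRing L v)) 0 0 w) = (u₁ : LocalRing L v) w * (1 + ε') := by
    rw [← coe_eA_apply L v w hw eA heA (eA.symm b) 0 0, ContinuousMulEquiv.apply_symm_apply, hb00, hcu]
  -- a unit of `L ⊗ L⁺_v = Π_{w′} L_{w′}` has non-zero components (no depth hypothesis on `u₁` is needed)
  have hu₁w0 : (u₁ : LocalRing L v) w ≠ 0 := (Pi.isUnit_iff.1 u₁.isUnit w).ne_zero
  have hε'1 : Valued.v (1 + ε') = 1 := by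
    refine Valued.v.map_one_add_of_lt (lt_of_le_of_lt hε' (pow_lt_one' ?_ (Nat.succ_ne_zero m)))
    rw [hϖ, ← WithZero.exp_zero, WithZero.exp_lt_exp]; norm_num
  have hε'0 : 1 + ε' ≠ 0 := fun h => by rw [h, map_zero] at hε'1; exact zero_ne_one hε'1
  have hU : IsUnit ((((eA.symm b).val : GL (Fin 3) (LocalRing L v)) : Matrix (Fin 3) (Fin 3) (LocalRing L v)) 0 0) := by
    refine isUnit_of_apply_ne_zero L v w hw _ ?_
    rw [h00w]
    exact mul_ne_zero hu₁w0 hε'0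
  rw [dif_pos hU]
  -- `e := unit (b₀)₀₀ · u₁⁻¹ ≡ 1 (mod 𝔭^{m+1})` at every place, hence killed by `χ₁`
  have he : ∀ w' : PlacesOver L v, Valued.v ((((hU.unit * u₁⁻¹ : (LocalRing L v)ˣ)) : LocalRing L v) w' - 1) ≤ Valued.v ϖ ^ (m + 1) := by
    intro w'
    obtain rfl := (PlacesOver.eq_of_smul_eq (IsCMField.complexConj L) (IsCMField.complexConj_ne_one L) w hw w').symm
    rw [Units.val_mul, Units.val_inv_eq_inv_val, Pi.mul_apply, Pi.inv_apply, IsUnit.unit_spec, h00w,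
      show (u₁ : LocalRing L v) w * (1 + ε') * ((u₁ : LocalRing L v) w)⁻¹ - 1 = ε' by field_simp; ring]
    exact hε'
  have hχe := hcond _ he
  have hunit : hU.unit = (hU.unit * u₁⁻¹) * u₁ := by rw [inv_mul_cancel_right]
  rw [hunit, map_mul, hχe, one_mul]
  intro heq
  exact hχu₁ (Units.val_eq_one.1 heq)

end Summit.HodgeConjecture.HodgeConjecture.Cruxes.H413.K2E3TwoDepthUpperShellWitnessCM

end
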